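import Summits.Ventures.CertifiedArithmetic.Expansions.CompressTerminatesAnyTie
import Mathlib.Tactic.Linarith
import Mathlib.Tactic.Ring
import Mathlib.Tactic.NormNum
import Mathlib.Tactic.Positivity

/-!
# A round-to-nearest that is not `RoundoffBelow 2` — the any-tie theorems are strictly more general

[cite: Shewchuk1997, §2.1 p. 310 and Cor 9 p. 315 (round-to-even tiebreaking)];
[cite: BoldoEtAl2023, §2.2 (ties-to-even; any tie-breaking rule)].

`CompressTerminates.compress_iterate_fixed` asks the rounding to satisfy `RoundoffBelow 2`
(every roundoff lies 2-below the rounded value — Shewchuk's hypothesis "round-to-even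
tiebreaking", `roundoffBelow_two_roundTiesEven`), whereas the theorems of `CompressTopStable` and
`CompressTerminatesAnyTie` only ask for `IsRoundNearest p emin fl`: nearest rounding with the
ties broken by ANY rule, possibly depending on the argument.  This file records, inside the
formal model, that the second hypothesis class is strictly larger, and instantiates the any-tie
theorems on a witness:

* `roundFlipTie p emin` — ties-to-even everywhere except at the single midpoint `2^p + 1`
  (half-way between the consecutive floats `2^p` and `2^p + 2`), where it returns `2^p + 2`,
  the neighbour with the ODD significand `2^(p-1) + 1`;
* `isRoundNearest_roundFlipTie` — it is a round-to-nearest (`p ≥ 2`, `emin ≤ 1`);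
* `not_roundoffBelow_two_roundFlipTie` — it is NOT `RoundoffBelow 2`: the roundoff at `2^p + 1`
  is `-1` while the rounded value `2^p + 2 = (2^(p-1) + 1)·2` lies on no grid coarser than `2ℤ`;
  hence `roundFlipTie_ne_roundTiesEven`;
* `compress_iterate_length_fixed_roundFlipTie`, `compress_compress_getLast_roundFlipTie` — the
  any-tie termination bound `|e|` and top stability for COMPRESS run with this rounding, to which
  `compress_iterate_fixed` does not apply.
-/

namespace Summit.Ventures.CertifiedArithmetic.Expansions

open Literature.ComputerArithmetic.JeannerodRump2018
open Literature.ComputerArithmetic.BoldoJeannerodMelquiondMuller2023 hiding twoSum twoSum_fst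
open Literature.ComputerArithmetic.Shewchuk1997

variable {p : ℕ} {emin : ℤ}

/-- Ties-to-even with ONE tie flipped: at `t = 2^p + 1` return `2^p + 2` (odd significand)
instead of `2^p`. [cite: BoldoEtAl2023, §2.2 (any tie-breaking rule)] -/
def roundFlipTie (p : ℕ) (emin : ℤ) (t : ℚ) : ℚ :=
  if t = 2 ^ p + 1 then 2 ^ p + 2 else roundTiesEven p emin t

/-- The flipped value. [cite: BoldoEtAl2023, §2.2] -/
theorem roundFlipTie_apply_tie (p : ℕ) (emin : ℤ) :
    roundFlipTie p emin (2 ^ p + 1) = 2 ^ p + 2 := by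
  simp [roundFlipTie]

/-- Elsewhere it is ties-to-even. [cite: BoldoEtAl2023, §2.2] -/
theorem roundFlipTie_of_ne {t : ℚ} (ht : t ≠ 2 ^ p + 1) :
    roundFlipTie p emin t = roundTiesEven p emin t := by
  simp [roundFlipTie, ht]

/-- `2^p + 2 = (2^(p-1) + 1)·2^1` is a precision-`p` float (`p ≥ 2`, `emin ≤ 1`).
[cite: BoldoEtAl2023, §2.1] -/
theorem isFloat_two_pow_add_two (hp : 2 ≤ p) (hemin : emin ≤ 1) :
    IsFloat p emin ((2 : ℚ) ^ p + 2) := by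
  obtain ⟨q, rfl⟩ : ∃ q, p = q + 2 := ⟨p - 2, by omega⟩
  refine ⟨2 ^ (q + 1) + 1, 1, ?_, hemin, ?_⟩
  · rw [abs_of_nonneg (by positivity)]
    have h1 : (1 : ℤ) < 2 ^ (q + 1) := one_lt_pow₀ (by norm_num) (by omega)
    calc (2 : ℤ) ^ (q + 1) + 1 < 2 ^ (q + 1) + 2 ^ (q + 1) := by linarith
      _ = 2 ^ (q + 2) := by ring
  · rw [zpow_one]; push_cast; ring

/-- Every precision-`p` float `f` (`p ≥ 2`) satisfies `1 ≤ |2^p + 1 − f|`: no float lies strictly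
between the consecutive floats `2^p` and `2^p + 2`. [cite: BoldoEtAl2023, §2.1] -/
theorem one_le_abs_two_pow_add_one_sub (hp : 2 ≤ p) {f : ℚ} (hf : IsFloat p emin f) :
    1 ≤ |(2 : ℚ) ^ p + 1 - f| := by
  obtain ⟨M, e, hM, -, rfl⟩ := hf
  have hMle : |M| ≤ 2 ^ p - 1 := by omega
  rcases le_or_gt e 0 with he | he
  · -- `|f| ≤ |M| ≤ 2^p - 1`
    have h2e : (2 : ℚ) ^ e ≤ 1 := zpow_le_one_of_nonpos₀ (by norm_num) he
    have hfle : |(M : ℚ) * 2 ^ e| ≤ 2 ^ p - 1 := by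
      rw [abs_mul, abs_of_pos (zpow_pos (by norm_num : (0 : ℚ) < 2) e)]
      have hMq : |(M : ℚ)| ≤ 2 ^ p - 1 := by exact_mod_cast hMle
      calc |(M : ℚ)| * 2 ^ e ≤ (2 ^ p - 1) * 1 :=
            mul_le_mul hMq h2e (le_of_lt (zpow_pos (by norm_num) e)) (by
              have : (1 : ℚ) ≤ 2 ^ p := one_le_pow₀ (by norm_num)
              linarith)
        _ = 2 ^ p - 1 := by ring
    have hf' : (M : ℚ) * 2 ^ e ≤ 2 ^ p - 1 := le_trans (le_abs_self _) hfle
    rw [abs_of_nonneg (by linarith)]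
    linarith
  · -- `f = M·2^e` with `e ≥ 1` is an even integer, `2^p + 1 - f` an odd one
    obtain ⟨d, hd⟩ : ∃ d : ℕ, e = (d : ℤ) + 1 := ⟨(e - 1).toNat, by omega⟩
    obtain ⟨q, rfl⟩ : ∃ q, p = q + 1 := ⟨p - 1, by omega⟩
    have hf : (M : ℚ) * 2 ^ e = ((M * 2 ^ d * 2 : ℤ) : ℚ) := by
      rw [hd, zpow_add_one₀ (by norm_num : (2 : ℚ) ≠ 0), zpow_natCast]; push_cast; ring
    have hodd : (2 : ℚ) ^ (q + 1) + 1 - (M : ℚ) * 2 ^ e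
        = ((2 * (2 ^ q - M * 2 ^ d) + 1 : ℤ) : ℚ) := by
      rw [hf]; push_cast; ring
    rw [hodd, ← Int.cast_abs]
    have hne : (2 * (2 ^ q - M * 2 ^ d) + 1 : ℤ) ≠ 0 := by omega
    exact_mod_cast Int.one_le_abs hne

/-- **`roundFlipTie` is a round-to-nearest** (`p ≥ 2`, `emin ≤ 1`): at the flipped tie both
neighbours are at distance `1` and no float is nearer. [cite: BoldoEtAl2023, §2.2] -/
theorem isRoundNearest_roundFlipTie (hp : 2 ≤ p) (hemin : emin ≤ 1) :
    IsRoundNearest p emin (roundFlipTie p emin) := by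
  intro t
  by_cases ht : t = 2 ^ p + 1
  · subst ht
    rw [roundFlipTie_apply_tie]
    refine ⟨isFloat_two_pow_add_two hp hemin, fun f hf => ?_⟩
    rw [show (2 : ℚ) ^ p + 1 - (2 ^ p + 2) = -1 by ring, abs_neg, abs_one]
    exact one_le_abs_two_pow_add_one_sub hp hf
  · rw [roundFlipTie_of_ne ht]
    exact isRoundNearest_roundTiesEven (le_trans (by norm_num) hp) t

/-- **`roundFlipTie` is not `RoundoffBelow 2`**: at `t = 2^p + 1` the roundoff is `-1`, and
`2·|−1| < 2^s` forces `s ≥ 2`, but `2^p + 2 ≡ 2 (mod 4)` lies on no grid `2^s ℤ` with `s ≥ 2`.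
So Shewchuk's round-to-even hypothesis (Cor 9) genuinely excludes some round-to-nearest maps.
[cite: Shewchuk1997, Cor 9 p. 315] -/
theorem not_roundoffBelow_two_roundFlipTie (hp : 2 ≤ p) (emin : ℤ) :
    ¬ RoundoffBelow 2 (roundFlipTie p emin) := by
  intro h
  obtain ⟨s, ⟨r, hr⟩, hlt⟩ := h (2 ^ p + 1)
  rw [roundFlipTie_apply_tie] at hr hlt
  rw [show (2 : ℚ) ^ p + 1 - (2 ^ p + 2) = -1 by ring, abs_neg, abs_one, mul_one] at hlt
  -- `2 < 2^s` forces `s ≥ 2`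
  have hs : 2 ≤ s := by
    by_contra hs
    have : (2 : ℚ) ^ s ≤ 2 ^ (1 : ℤ) := zpow_le_zpow_right₀ (by norm_num) (by omega)
    rw [zpow_one] at this
    linarith
  obtain ⟨d, hd⟩ : ∃ d : ℕ, s = (d : ℤ) + 2 := ⟨(s - 2).toNat, by omega⟩
  obtain ⟨q, rfl⟩ : ∃ q, p = q + 2 := ⟨p - 2, by omega⟩
  rw [hd, zpow_add₀ (by norm_num : (2 : ℚ) ≠ 0), zpow_natCast] at hr
  have hz : ((2 : ℤ) ^ (q + 2) + 2 : ℤ) = r * 2 ^ d * 4 := by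
    have hr' : (2 : ℚ) ^ (q + 2) + 2 = (r : ℚ) * 2 ^ d * 4 := by
      rw [hr]; norm_num; ring
    exact_mod_cast hr'
  have h4 : (4 : ℤ) ∣ 2 := by
    have h1 : (4 : ℤ) ∣ r * 2 ^ d * 4 := ⟨r * 2 ^ d, by ring⟩
    have h2 : (4 : ℤ) ∣ 2 ^ (q + 2) := ⟨2 ^ q, by ring⟩
    have h3 : (4 : ℤ) ∣ 2 ^ (q + 2) + 2 := hz ▸ h1
    exact (dvd_add_right h2).mp h3
  omega

/-- Consequently `roundFlipTie` is a round-to-nearest different from ties-to-even.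
[cite: BoldoEtAl2023, §2.2] -/
theorem roundFlipTie_ne_roundTiesEven (hp : 2 ≤ p) (emin : ℤ) :
    roundFlipTie p emin ≠ roundTiesEven p emin := fun h =>
  not_roundoffBelow_two_roundFlipTie hp emin (h ▸ roundoffBelow_two_roundTiesEven p emin)

/-- The any-tie termination theorem instantiated: COMPRESS run with `roundFlipTie` reaches its
fixed point after at most `|e|` passes on every nonoverlapping expansion — a case outside
`compress_iterate_fixed`. [cite: Shewchuk1997, §2.7 pp. 331–333] -/
theorem compress_iterate_length_fixed_roundFlipTie (hp : 2 ≤ p) (hemin : emin ≤ 1)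
    {e : List ℚ} (he : ∀ x ∈ e, IsFloat p emin x) (hexp : IsExpansion 1 e) :
    (compress (roundFlipTie p emin))^[e.length + 1] e
      = (compress (roundFlipTie p emin))^[e.length] e :=
  compress_iterate_length_fixed hp (isRoundNearest_roundFlipTie hp hemin) he hexp

/-- Top stability instantiated: a second COMPRESS pass with `roundFlipTie` keeps the top
component. [cite: Shewchuk1997, §2.7 pp. 331–333] -/
theorem compress_compress_getLast_roundFlipTie (hp : 2 ≤ p) (hemin : emin ≤ 1)
    {e : List ℚ} (he : ∀ x ∈ e, IsFloat p emin x) (hexp : IsExpansion 1 e) :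
    (compress (roundFlipTie p emin) (compress (roundFlipTie p emin) e)).getLast?
      = (compress (roundFlipTie p emin) e).getLast? :=
  compress_compress_getLast hp (isRoundNearest_roundFlipTie hp hemin) he hexp

end Summit.Ventures.CertifiedArithmetic.Expansions
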